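import Literature.NumberTheory.LFunctions.ZetaZeroSumsLehmanExplicit
import Literature.NumberTheory.LFunctions.SchoenfeldZerosLow
import Literature.NumberTheory.LFunctions.SoundZeroWindowSums
import HarnessLib

/-!
# RH-FREE — `Σ_{0<γ≤T} 1/γ ≤ log²(T/2π)/(4π)` for `T ≥ 2516` from `|N(T) − L(T)| ≤ 0.28 log T` and the tree's certified first `2000` zeros («nothing here bears on the truth of RH»)

Topic `Literature/NumberTheory/LFunctions` (RH literature-typing tranche 1, L4 "explicit zero
statistics", gen 2). THEOREMS only (no definitions, no named facts). Nothing here bears on the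
truth of RH.

Brent–Platt–Trudgian 2022 (J. Number Theory 238, §2), **Lemma 8**: "If `T ≥ 4πe`, then
`Σ_{0<γ≤T} 1/γ ≤ L̂²/(4π)`", `L̂ = log(T/2π)` — vendored as the named fact
`Literature.NumberTheory.LFunctions.BrentPlattTrudgian2022_lemma8` in `ZetaZeroSumsLehmanExplicit.lean`.
Its printed proof: Lehman's lemma with `φ(t) = 1/t` from `T₁ = 202` (with `A = 0.28`, their
Corollary 1), the first `80` zeros to show `ε(202) < 0`, and a numerical check on `[4πe, 202)`.
Here the same argument is carried out IN THE KERNEL from `T₁ = 2516`, where the tree holds the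
first `2000` zeros as certified data (`SchoenfeldZerosLow.lean`: brackets of width `2⁻²⁴⁰`,
`N(2516) = 2000`, all simple on the critical line, and the integer sum
`SchoenfeldBound.invOrdSum 2000` with `SchoenfeldBound.lowSums_check`):

* `sum_inv_ordinate_low_le` — `Σ_{0<γ≤2516} m(ρ)/γ ≤ 2.8405` (the one-sided half of the tree's
  `SchoenfeldBound.sumInvNorm_heightT0_le`, re-run on `1/γ`);
* the split `Σ_{0<γ≤T} = Σ_{0<γ≤2516} + Σ_{2516<γ≤T}` is the tree's `SoundTest.sum_zerosBetween_split`;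
* `BrentPlattTrudgian2022_cor1.sum_inv_le_of_ge_2516` — **for `T ≥ 2516`,
  `Σ_{0<γ≤T} m(ρ)/γ ≤ log²(T/2π)/(4π)`**, from `BrentPlattTrudgian2022_cor1` (`A = 0.28`) via
  `BrentPlattTrudgian2022_cor1.abs_sum_inv_sub_le` (the harmonic sum between `2516` and `T`) and
  the numerics `ε(2516) = 2.8405 − log²(2516/2π)/(4π) + 0.28(2 log 2516 + 1)/2516 < 0`
  (`log(2516/2π) ≥ 5.99`, `log 2516 ≤ 8`).

So, modulo the single named fact `BrentPlattTrudgian2022_cor1`, Lemma 8 is a theorem of the tree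
on `[2516, ∞)`; the printed range `[4πe, 2516)` would need the same step-function check against
the `2000` brackets (not done here).

## References

* R. P. Brent, D. J. Platt, T. S. Trudgian, J. Number Theory 238 (2022) 740–762, §2, Lemma 8 and
  Cor. 1. [BrentPlattTrudgian2022]
* A. M. Odlyzko, H. J. J. te Riele, J. reine angew. Math. 357 (1985), §4.2 (the first `2000`
  zeros; the tree's certificate). [OdlyzkoTeRiele1985]
-/

noncomputable section

open Complex Filter Set MeasureTheory
open scoped Real

namespace Literature.NumberTheory.LFunctions

open SchoenfeldBound ZetaNumerics.Mertens

/-! ## The first `2000` zeros: `Σ_{0<γ≤2516} 1/γ ≤ 2.8405` -/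

/-- **`Σ_{0<γ≤2516} m(ρ)/γ ≤ 2.8405`** from the tree's certified brackets of the first `2000` zeros
(`Σ_j 1/γ_j ≤ Σ_j 2⁻⁶⁰ ⌈2³⁰⁰/a_j⌉ = invOrdSum 2000 / 2⁶⁰ ≤ 5.681/2`, the integer inequality
`SchoenfeldBound.lowSums_check`). [cite: OdlyzkoTeRiele1985, §4.2 p. 151]
[cite: BrentPlattTrudgian2022, Lemma 8 (proof: "summing over the first 80 nontrivial zeros")] -/
theorem sum_inv_ordinate_low_le :
    ∑ ρ ∈ zerosBetween 0 (heightT0 : ℝ), (riemannZetaZeroOrder ρ : ℝ) * (1 / ρ.im) ≤ 2.8405 := by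
  classical
  rw [zerosBetween_zero_heightT0]
  have heinj : Set.InjOn (fun j ↦ (1 / 2 + lowOrdinate j * I : ℂ)) (Finset.range 2000 : Set ℕ) := by
    intro j hj j' hj' h
    exact lowOrdinate_injOn hj hj' (by have := congrArg Complex.im h; simpa using this)
  rw [Finset.sum_image heinj]
  have hterm : ∀ j ∈ Finset.range 2000,
      (riemannZetaZeroOrder (1 / 2 + lowOrdinate j * I) : ℝ) * (1 / (1 / 2 + lowOrdinate j * I : ℂ).im) ≤
        (invOrdTerm j : ℝ) / 2 ^ 60 := by
    intro j hj
    rw [Finset.mem_range] at hj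
    rw [riemannZetaZeroOrder_lowOrdinate hj]
    have him : (1 / 2 + lowOrdinate j * I : ℂ).im = lowOrdinate j := by simp
    rw [him, Int.cast_one, one_mul, one_div]
    have ht := (lowOrdinate_spec hj).1.1
    exact (inv_anti₀ (t₁_pos hj) ht).trans (inv_t₁_le hj)
  have hsum := Finset.sum_le_sum hterm
  rw [← Finset.sum_div] at hsum
  have hnat : ∑ j ∈ Finset.range 2000, (invOrdTerm j : ℝ) = (invOrdSum 2000 : ℝ) := by
    rw [invOrdSum_eq]; push_cast; rfl
  rw [hnat] at hsum
  have hchk : (invOrdSum 2000 : ℝ) * 2000 ≤ 5681 * 2 ^ 60 := by exact_mod_cast lowSums_check.1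
  have : (invOrdSum 2000 : ℝ) / 2 ^ 60 ≤ 2.8405 := by
    rw [div_le_iff₀ (by positivity)]; linarith
  exact hsum.trans this

/-! ## Lemma 8 on `[2516, ∞)` from Corollary 1 -/

/-- `log(2516/2π) ≥ 5.99` and `log 2516 ≤ 8` (from `e < 2.7182818286`, `e > 2.7182818283`,
`π < 3.1416`, `exp 0.01 ≥ 1.01`). [folklore] -/
private theorem log_bounds_2516 :
    5.99 ≤ Real.log (2516 / (2 * π)) ∧ Real.log 2516 ≤ 8 := by
  have hπ3 : 3 < π := Real.pi_gt_three
  have hπ4 : π < 3.1416 := by linarith [Real.pi_lt_d6]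
  have he1 : Real.exp 1 < 2.7182818286 := Real.exp_one_lt_d9
  have he2 : 2.7182818283 < Real.exp 1 := Real.exp_one_gt_d9
  have h2π : (0 : ℝ) < 2 * π := by positivity
  constructor
  · rw [Real.le_log_iff_exp_le (div_pos (by norm_num) h2π), le_div_iff₀ h2π]
    -- exp 5.99 · exp 0.01 = exp 6 = (exp 1)^6 < 2.7182818286^6, exp 0.01 ≥ 1.01
    have h6 : Real.exp 6 = Real.exp 1 ^ 6 := by
      rw [← Real.exp_nat_mul]; norm_num
    have h6b : Real.exp 6 < 403.43 := by
      rw [h6]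
      have : Real.exp 1 ^ 6 < 2.7182818286 ^ 6 := by gcongr
      linarith [show (2.7182818286 : ℝ) ^ 6 < 403.43 by norm_num]
    have hsplit : Real.exp 5.99 * Real.exp 0.01 = Real.exp 6 := by
      rw [← Real.exp_add]; norm_num
    have h001 : (1.01 : ℝ) ≤ Real.exp 0.01 := by
      have := Real.add_one_le_exp (0.01 : ℝ); linarith
    have hpos : 0 < Real.exp 5.99 := Real.exp_pos _
    nlinarith
  · rw [Real.log_le_iff_le_exp (by norm_num)]
    have h8 : Real.exp 8 = Real.exp 1 ^ 8 := by
      rw [← Real.exp_nat_mul]; norm_num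
    rw [h8]
    have : (2.7182818283 : ℝ) ^ 8 ≤ Real.exp 1 ^ 8 := by gcongr
    linarith [show (2516 : ℝ) ≤ 2.7182818283 ^ 8 by norm_num]

set_option maxHeartbeats 400000 in -- unification of the decimal-constant instance is slow
/-- **Brent–Platt–Trudgian 2022, Lemma 8, on `[2516, ∞)`, proved from Corollary 1 and the tree's
first `2000` zeros**: for `T ≥ 2516`, `Σ_{0<γ≤T} m(ρ)/γ ≤ log²(T/2π)/(4π)` (ordinates with
multiplicity). Proof: split at `2516`; below, `≤ 2.8405` (`sum_inv_ordinate_low_le`); above,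
Lehman's lemma (`BrentPlattTrudgian2022_cor1.abs_sum_inv_sub_le`); and
`2.8405 − log²(2516/2π)/(4π) + 0.28(2 log 2516 + 1)/2516 < 0`.
[cite: BrentPlattTrudgian2022, Lemma 8 and Cor. 1] -/
theorem BrentPlattTrudgian2022_cor1.sum_inv_le_of_ge_2516 (h : BrentPlattTrudgian2022_cor1) {T : ℝ}
    (hT : 2516 ≤ T) :
    ∑ ρ ∈ zerosBetween 0 T, (riemannZetaZeroOrder ρ : ℝ) / ρ.im ≤ Real.log (T / (2 * π)) ^ 2 / (4 * π) := by
  have hπ3 : 3 < π := Real.pi_gt_three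
  have hπ4 : π < 3.1416 := by linarith [Real.pi_lt_d6]
  have h4π : (0 : ℝ) < 4 * π := by positivity
  have hH : ((heightT0 : ℕ) : ℝ) = 2516 := by norm_num [heightT0]
  have h2π2516 : 2 * π ≤ (2516 : ℝ) := by linarith
  -- rewrite the sum with `* (1/γ)` and split at 2516
  have e : ∑ ρ ∈ zerosBetween 0 T, (riemannZetaZeroOrder ρ : ℝ) / ρ.im =
      ∑ ρ ∈ zerosBetween 0 T, (riemannZetaZeroOrder ρ : ℝ) * (1 / ρ.im) :=
    Finset.sum_congr rfl fun ρ _ ↦ by ring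
  rw [e, SoundTest.sum_zerosBetween_split le_rfl (by norm_num : (0 : ℝ) ≤ 2516) hT]
  have hlow := sum_inv_ordinate_low_le
  rw [hH] at hlow
  have hup := (abs_le.1 (h.abs_sum_inv_sub_le h2π2516 hT)).2
  obtain ⟨hl1, hl2⟩ := log_bounds_2516
  -- numerics: 2.8405 - log²(2516/2π)/(4π) + 0.28 (2 log 2516 + 1)/2516 ≤ 0
  have hA : Real.log (2516 / (2 * π)) ^ 2 / (4 * π) ≥ 5.99 ^ 2 / (4 * 3.1416) := by
    have hsq : (5.99 : ℝ) ^ 2 ≤ Real.log (2516 / (2 * π)) ^ 2 := by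
      have : (0 : ℝ) ≤ 5.99 := by norm_num
      nlinarith
    calc (5.99 : ℝ) ^ 2 / (4 * 3.1416) ≤ 5.99 ^ 2 / (4 * π) := by
          apply div_le_div_of_nonneg_left (by norm_num) h4π; linarith
      _ ≤ Real.log (2516 / (2 * π)) ^ 2 / (4 * π) := div_le_div_of_nonneg_right hsq h4π.le
  have hB : 0.28 * (2 * Real.log 2516 + 1) / 2516 ≤ 0.28 * 17 / 2516 := by
    apply div_le_div_of_nonneg_right _ (by norm_num)
    nlinarith
  have hnum : (5.99 : ℝ) ^ 2 / (4 * 3.1416) ≥ 2.855 := by norm_num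
  have hnum2 : (0.28 : ℝ) * 17 / 2516 ≤ 0.0019 := by norm_num
  have hsd : (Real.log (T / (2 * π)) ^ 2 - Real.log (2516 / (2 * π)) ^ 2) / (4 * π) =
      Real.log (T / (2 * π)) ^ 2 / (4 * π) - Real.log (2516 / (2 * π)) ^ 2 / (4 * π) :=
    sub_div _ _ _
  rw [hsd] at hup
  linarith

end Literature.NumberTheory.LFunctions

end
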